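import Summits.BirchSwinnertonDyer.BirchSwinnertonDyer.Theorems.PrintCFramBottomClassIndexLawFiveLeHerbrandRayClassDevissage
import Literature.NumberTheory.NumberFields.RayClassFieldSplitTwoPowerDegree
import Literature.NumberTheory.QuadraticFields.ClassNumberOne
import Literature.NumberTheory.QuadraticFields.HeegnerCondition
import HarnessLib

/-!
# The ray class number formula `#Cl_K^𝔪 · #im(𝓞ˣ → (𝓞/𝔪)ˣ) = h_K · #(𝓞/𝔪)ˣ` (Neukirch VI (1.11))
# and the ABSOLUTE degrees `[K(v^{n+1}) : K] = h_K · 2^{n-1}` of the `𝔣 = 1` division tower at a split `2`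
# (`= 2^{n-1}` for `K = ℚ(√-7)`)

Summit `BirchSwinnertonDyer`, cell `bsd-print-cf2`, crux `PrintCf2.SplitBadTwoRankOneOfFacts`
(stmt-BirchSwinnertonDyer-20368) / `MainConjClauseAtSplitTwoQuadDA` (stmt-24721); width seat
`bsd-line-cf2-p1-w3` g19, idle-width item **(M9) B2-GLOBAL-SPLIT, STAGE 6** (planner g20 13:46:07Z: «so
`[K(𝔭^{n+1}) : K] = 2^{n-1}`; this is the instance cf2c-w4's (d) will actually call»).  Stages 1–5 (w3 g18,
`Literature/NumberTheory/GaloisRepresentations/RayClassGroupModulusChange*.lean`,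
`…/RayClassGroupPrimePowerKernel.lean`, `Literature/NumberTheory/NumberFields/RayClassFieldSplit*PowerDegree*.lean`)
give the RELATIVE degrees `[K(𝔣𝔭^{n+1}) : K(𝔣𝔭)] = p^n` and, at `𝔣 = 1`, `[K(v^{n+1}) : K(v)] = 2^{n-1}`;
what was missing is the BOTTOM `[K(v) : K] = h_K` (`#Cl_K^{v} = h_K` because `(𝓞/v)ˣ = 𝔽₂ˣ = 1`), i.e.
Neukirch's exact sequence

  `1 → 𝓞ˣ/𝓞ˣ_{𝔪,1} → (𝓞/𝔪)ˣ → Cl_K^𝔪 → Cl_K → 1`     (VI (1.11), `K` totally complex: no signs)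

in cardinality form.  HONEST FRAMING: generic algebraic number theory; it is Summits-side only because it
consumes the cfram seat's dévissage `…Theorems.PrintCFram.HerbrandRayClassDevissage` (the unit-side map
`exists_unitsQuot_hom`, `exists_coprimeIdeal_idealClass_eq`, `integralRayClass_span_*`), which a
Literature file cannot import.  No summit statement is proved here; no stub is closed; BSD is not proved
by any of this.

## What is here (theorems only; no definition, no named fact, no `sorry`)

* §1 (`K` any number field, `𝔪 ≠ 0`): **`exists_toClassGroup`** — the forgetful homomorphism `f : Cl_K^𝔪 →* Cl_K`, `[𝔞] ↦ cl 𝔞`, as an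
  existential pinned by its values on integral classes; `toClassGroup_surjective` (every ideal class meets
  `J^𝔪`); hence `classNumber_dvd_natCard_rayClassGroup` (`h_K ∣ #Cl_K^𝔪`).
* §2 (`K` totally complex): `ker_toClassGroup_eq_range` (`ker f = im((𝓞/𝔪)ˣ → Cl^𝔪)`),
  `ker_unitsQuot_eq_range` (`ker((𝓞/𝔪)ˣ → Cl^𝔪) = im(𝓞ˣ)`), and ★
  **`natCard_rayClassGroup_mul_natCard_range_units`**:
  `#Cl_K^𝔪 · #im(𝓞ˣ → (𝓞/𝔪)ˣ) = h_K · #(𝓞/𝔪)ˣ`; `natCard_rayClassGroup_eq_classNumber_of_natCard_units_eq_one`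
  (`(𝓞/𝔪)ˣ = 1 ⟹ #Cl^𝔪 = h_K`); `natCard_rayClassGroup_mul_natCard_units_of_forall_units` (de Shalit's `w_𝔪 = 1`
  form `#Cl^𝔪 · #𝓞ˣ = h_K · #(𝓞/𝔪)ˣ`).
* §3 (`[K:ℚ] = 2` totally complex, `2 = v v̄` split): `natCard_units_quotient_eq_one_of_natCard_eq_two`
  (`#(𝓞/v)ˣ = 1`), ★ `natCard_rayClassGroup_eq_classNumber_of_split_two` (`#Cl^{v} = h_K`),
  `finrank_rayClassField_eq_classNumber_of_split_two` (`[K(v) : K] = h_K`), ★★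
  `finrank_rayClassField_pow_succ_eq_classNumber_mul` (`[K(v^{n+1}) : K] = h_K · 2^{n-1}`, `n ≥ 1`,
  `𝓞ˣ = {±1}`).
* §4 (`K` imaginary quadratic, `d_K = -7`: `h_K = 1` by the tree's Minkowski computation
  `QuadraticFields.Quadratic.isPrincipalIdealRing_of_sq_eq_intCast`): `rayClassField_eq_bot_of_discr_eq_neg_seven`
  (`K(v) = K`), ★★ `finrank_rayClassField_pow_succ_of_discr_eq_neg_seven` (`[K(v^{n+1}) : K] = 2^{n-1}`) and
  the Galois form `index_fixingSubgroup_rayClassField_pow_succ_of_discr_eq_neg_seven`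
  (`[Γ_K : Gal(K̄/K(v^{n+1}))] = 2^{n-1}`).

References: J. Neukirch, *Algebraic Number Theory* (1999), Ch. VI §1 Prop. (1.11), Exercise 13
[NeukirchANT1999]; E. de Shalit, *Iwasawa theory of elliptic curves with complex multiplication* (1987),
II.1.9 (p. 43) [deShalit1987].
-/

noncomputable section

-- summit-side namespace `Summit.BirchSwinnertonDyer.BirchSwinnertonDyer.…` (single-conjunct summit, D-0017 layout)
set_option linter.dupNamespace false
set_option autoImplicit false

open scoped Classical nonZeroDivisors
open NumberField IsDedekindDomain IsDedekindDomain.HeightOneSpectrum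
open Literature.NumberTheory.GaloisRepresentations Literature.NumberTheory.LFunctions
open Summit.BirchSwinnertonDyer.BirchSwinnertonDyer.Theorems.PrintCFram.HerbrandRayClassDevissage

namespace Summit.BirchSwinnertonDyer.BirchSwinnertonDyer.Theorems.PrintCf2.RayClassNumberFormula

variable {K : Type*} [Field K] [NumberField K] {𝔪 : Ideal (𝓞 K)}

/-! ### §1 The forgetful homomorphism `Cl_K^𝔪 → Cl_K` -/

/-- **The forgetful homomorphism `Cl_K^𝔪 → Cl_K`, `[𝔞] ↦ cl(𝔞)`** (drop the congruence condition), as an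
existential pinned by its values on the classes of integral ideals prime to `𝔪` (which exhaust `Cl_K^𝔪`,
`integralRayClass_surjective`). [cite: NeukirchANT1999, Ch. VI §1 Prop. (1.11)] -/
theorem exists_toClassGroup (h𝔪 : 𝔪 ≠ ⊥) :
    ∃ f : RayClassGroup 𝔪 →* ClassGroup (𝓞 K),
      ∀ 𝔞 : CoprimeIdeal 𝔪, f (integralRayClass 𝔪 h𝔪 𝔞) = 𝔞.idealClass := by
  have hker : (ray 𝔪).subgroupOf (idealsPrimeTo 𝔪) ≤
      ((ClassGroup.mk K).comp (idealsPrimeTo 𝔪).subtype).ker := by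
    intro x hx
    rw [Subgroup.mem_subgroupOf] at hx
    obtain ⟨a, -, ha⟩ := Subgroup.mem_map.mp hx
    -- `[(a)] = 1` in `Cl_K` (the tree's `CMTypeLattice.classGroupMk_toPrincipalIdeal`, inlined to keep the imports light)
    rw [MonoidHom.mem_ker, MonoidHom.comp_apply, Subgroup.subtype_apply, ← ha, ClassGroup.mk_eq_one_iff,
      coe_toPrincipalIdeal, FractionalIdeal.coe_spanSingleton]
    exact ⟨⟨a, rfl⟩⟩
  refine ⟨QuotientGroup.lift _ _ hker, fun 𝔞 ↦ ?_⟩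
  unfold integralRayClass
  rw [QuotientGroup.lift_mk, MonoidHom.comp_apply, Subgroup.subtype_apply, CoprimeIdeal.idealClass,
    ← ClassGroup.mk_mk0 K]
  rfl

/-- **`Cl_K^𝔪 → Cl_K` is onto**: every ideal class contains an ideal prime to `𝔪`
(`exists_coprimeIdeal_idealClass_eq`). [cite: NeukirchANT1999, Ch. VI §1 Prop. (1.11), Exercise 13] -/
theorem toClassGroup_surjective (h𝔪 : 𝔪 ≠ ⊥) (f : RayClassGroup 𝔪 →* ClassGroup (𝓞 K))
    (hf : ∀ 𝔞 : CoprimeIdeal 𝔪, f (integralRayClass 𝔪 h𝔪 𝔞) = 𝔞.idealClass) :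
    Function.Surjective f := by
  intro C
  obtain ⟨𝔞, h𝔞⟩ := exists_coprimeIdeal_idealClass_eq h𝔪 C
  exact ⟨integralRayClass 𝔪 h𝔪 𝔞, by rw [hf, h𝔞]⟩

/-- **`h_K ∣ #Cl_K^𝔪`** for every number field `K` and every `𝔪 ≠ 0` (the narrow ray class number is a
multiple of the class number). [cite: NeukirchANT1999, Ch. VI §1 Prop. (1.11)] -/
theorem classNumber_dvd_natCard_rayClassGroup (h𝔪 : 𝔪 ≠ ⊥) :
    classNumber K ∣ Nat.card (RayClassGroup 𝔪) := by
  obtain ⟨f, hf⟩ := exists_toClassGroup (K := K) h𝔪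
  refine ⟨Nat.card f.ker, ?_⟩
  rw [mul_comm, ← Subgroup.card_mul_index f.ker, Subgroup.index_ker,
    MonoidHom.range_eq_top.mpr (toClassGroup_surjective h𝔪 f hf), Subgroup.card_top, classNumber,
    ← Nat.card_eq_fintype_card]

/-! ### §2 The exact sequence `𝓞ˣ → (𝓞/𝔪)ˣ → Cl_K^𝔪 → Cl_K → 1` (totally complex `K`) -/

/-- **`ker(Cl_K^𝔪 → Cl_K) = im((𝓞/𝔪)ˣ → Cl_K^𝔪)`**: a class `[𝔞]` with `𝔞 = (a)` principal is the class
of the unit `a mod 𝔪`, and conversely `[(a)] ↦ cl((a)) = 1`. [cite: NeukirchANT1999, Ch. VI §1 Prop. (1.11)] -/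
theorem ker_toClassGroup_eq_range [IsTotallyComplex K] (h𝔪 : 𝔪 ≠ ⊥)
    (f : RayClassGroup 𝔪 →* ClassGroup (𝓞 K))
    (hf : ∀ 𝔞 : CoprimeIdeal 𝔪, f (integralRayClass 𝔪 h𝔪 𝔞) = 𝔞.idealClass)
    (η : (𝓞 K ⧸ 𝔪)ˣ →* RayClassGroup 𝔪)
    (hη : ∀ (x : (𝓞 K ⧸ 𝔪)ˣ) (a : 𝓞 K) (ha : Ideal.span {a} ≠ ⊥ ∧ IsCoprime (Ideal.span {a}) 𝔪),
      Ideal.Quotient.mk 𝔪 a = x → η x = integralRayClass 𝔪 h𝔪 ⟨Ideal.span {a}, ha⟩) :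
    f.ker = η.range := by
  apply le_antisymm
  · intro c hc
    obtain ⟨𝔞, rfl⟩ := integralRayClass_surjective h𝔪 c
    rw [MonoidHom.mem_ker, hf] at hc
    have hP : (𝔞.1 : Ideal (𝓞 K)).IsPrincipal :=
      (ClassGroup.mk0_eq_one_iff (mem_nonZeroDivisors_iff_ne_zero.mpr 𝔞.2.1)).mp hc
    obtain ⟨a, ha⟩ := hP
    have ha' : 𝔞.1 = Ideal.span {a} := ha
    have hadm : Ideal.span {a} ≠ ⊥ ∧ IsCoprime (Ideal.span {a}) 𝔪 := by rw [← ha']; exact 𝔞.2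
    have hau : IsUnit (Ideal.Quotient.mk 𝔪 a) := (isCoprime_span_singleton_iff_isUnit_mk a).mp hadm.2
    refine ⟨hau.unit, ?_⟩
    rw [hη hau.unit a hadm hau.unit_spec.symm]
    exact integralRayClass_congr h𝔪 ha'.symm
  · rintro c ⟨x, rfl⟩
    obtain ⟨a, ha, hax⟩ := exists_lift_of_unit h𝔪 x
    rw [MonoidHom.mem_ker, hη x a ha hax, hf]
    exact (ClassGroup.mk0_eq_one_iff _).mpr ⟨⟨a, rfl⟩⟩

/-- **`ker((𝓞/𝔪)ˣ → Cl_K^𝔪) = im(𝓞ˣ)`**: `[(a)] = 1 = [(1)]` means `(c)(1) = (b)(a)` with `b ≡ c mod 𝔪`,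
`c` prime to `𝔪`; so `c u = b a ≡ c a` for a unit `u`, and `a ≡ u mod 𝔪`.
[cite: NeukirchANT1999, Ch. VI §1 Prop. (1.11)] -/
theorem ker_unitsQuot_eq_range [IsTotallyComplex K] (h𝔪 : 𝔪 ≠ ⊥)
    (η : (𝓞 K ⧸ 𝔪)ˣ →* RayClassGroup 𝔪)
    (hη : ∀ (x : (𝓞 K ⧸ 𝔪)ˣ) (a : 𝓞 K) (ha : Ideal.span {a} ≠ ⊥ ∧ IsCoprime (Ideal.span {a}) 𝔪),
      Ideal.Quotient.mk 𝔪 a = x → η x = integralRayClass 𝔪 h𝔪 ⟨Ideal.span {a}, ha⟩) :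
    η.ker = (Units.map (Ideal.Quotient.mk 𝔪).toMonoidHom : (𝓞 K)ˣ →* (𝓞 K ⧸ 𝔪)ˣ).range := by
  apply le_antisymm
  · intro x hx
    rw [MonoidHom.mem_ker] at hx
    obtain ⟨a, ha, hax⟩ := exists_lift_of_unit h𝔪 x
    rw [hη x a ha hax] at hx
    have htop : (⊤ : Ideal (𝓞 K)) ≠ ⊥ ∧ IsCoprime (⊤ : Ideal (𝓞 K)) 𝔪 := by
      rw [← Ideal.one_eq_top]; exact ⟨one_ne_zero, isCoprime_one_left⟩
    rw [← integralRayClass_top h𝔪 htop, integralRayClass_eq_iff h𝔪] at hx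
    obtain ⟨b, c, -, -, hccop, hbc, -, heq⟩ := hx
    change Ideal.span {c} * ⊤ = Ideal.span {b} * Ideal.span {a} at heq
    rw [Ideal.mul_top, Ideal.span_singleton_mul_span_singleton, Ideal.span_singleton_eq_span_singleton] at heq
    obtain ⟨u, hu⟩ := heq
    refine ⟨u, ?_⟩
    apply Units.ext
    rw [Units.coe_map, ← hax]
    change Ideal.Quotient.mk 𝔪 (u : 𝓞 K) = Ideal.Quotient.mk 𝔪 a
    rw [Ideal.Quotient.eq]
    apply mem_of_mul_mem_of_isCoprime_span hccop
    have e : ((u : 𝓞 K) - a) * c = c * u - b * a + (b - c) * a := by ring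
    rw [e, hu, sub_self, zero_add]
    exact 𝔪.mul_mem_right _ hbc
  · rintro x ⟨u, rfl⟩
    rw [MonoidHom.mem_ker, hη _ (u : 𝓞 K) (span_unit_ne_bot_and_isCoprime u) (by simp)]
    exact integralRayClass_span_unit h𝔪 u _

/-- ★ **The ray class number formula (Neukirch VI (1.11)) for a totally complex `K`:
`#Cl_K^𝔪 · #im(𝓞_Kˣ → (𝓞_K/𝔪)ˣ) = h_K · #(𝓞_K/𝔪)ˣ`** — the exact sequence
`1 → 𝓞ˣ/𝓞ˣ_{𝔪,1} → (𝓞/𝔪)ˣ → Cl_K^𝔪 → Cl_K → 1` in cardinality form (no archimedean signs since `K`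
has no real place). [cite: NeukirchANT1999, Ch. VI §1 Prop. (1.11)] [cite: deShalit1987, II.1.9 (p. 43)] -/
theorem natCard_rayClassGroup_mul_natCard_range_units [IsTotallyComplex K] (h𝔪 : 𝔪 ≠ ⊥) :
    Nat.card (RayClassGroup 𝔪) *
        Nat.card (Units.map (Ideal.Quotient.mk 𝔪).toMonoidHom : (𝓞 K)ˣ →* (𝓞 K ⧸ 𝔪)ˣ).range =
      classNumber K * Nat.card (𝓞 K ⧸ 𝔪)ˣ := by
  obtain ⟨f, hf⟩ := exists_toClassGroup (K := K) h𝔪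
  obtain ⟨η, hη⟩ := exists_unitsQuot_hom (K := K) h𝔪
  have h1 : Nat.card (RayClassGroup 𝔪) = Nat.card f.ker * classNumber K := by
    rw [← Subgroup.card_mul_index f.ker, Subgroup.index_ker,
      MonoidHom.range_eq_top.mpr (toClassGroup_surjective h𝔪 f hf), Subgroup.card_top, classNumber,
      ← Nat.card_eq_fintype_card]
  have h2 : Nat.card (𝓞 K ⧸ 𝔪)ˣ = Nat.card η.ker * Nat.card η.range := by
    rw [← Subgroup.card_mul_index η.ker, Subgroup.index_ker]
  rw [h1, h2, ker_toClassGroup_eq_range h𝔪 f hf η hη, ker_unitsQuot_eq_range h𝔪 η hη]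
  ring

/-- **`(𝓞/𝔪)ˣ = 1 ⟹ #Cl_K^𝔪 = h_K`** (totally complex `K`): the ray class field modulo a prime of norm `2`
is the Hilbert class field. [cite: NeukirchANT1999, Ch. VI §1 Prop. (1.11)] -/
theorem natCard_rayClassGroup_eq_classNumber_of_natCard_units_eq_one [IsTotallyComplex K] (h𝔪 : 𝔪 ≠ ⊥)
    (h1 : Nat.card (𝓞 K ⧸ 𝔪)ˣ = 1) : Nat.card (RayClassGroup 𝔪) = classNumber K := by
  have h := natCard_rayClassGroup_mul_natCard_range_units (K := K) h𝔪
  haveI : Finite (𝓞 K ⧸ 𝔪)ˣ := Nat.finite_of_card_ne_zero (by rw [h1]; exact one_ne_zero)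
  have hr : Nat.card (Units.map (Ideal.Quotient.mk 𝔪).toMonoidHom : (𝓞 K)ˣ →* (𝓞 K ⧸ 𝔪)ˣ).range = 1 :=
    Nat.dvd_one.mp (h1 ▸ Subgroup.card_subgroup_dvd_card _)
  rwa [hr, h1, mul_one, mul_one] at h

/-- **de Shalit's form under `w_𝔪 = 1`: `#Cl_K^𝔪 · #𝓞_Kˣ = h_K · #(𝓞_K/𝔪)ˣ`** — if no unit `≠ 1` is `≡ 1 mod 𝔪`
then `𝓞ˣ → (𝓞/𝔪)ˣ` is injective, so `#im(𝓞ˣ) = #𝓞ˣ = w_K` (totally complex `K`; e.g. `[K(𝔣) : K] = h_K·Φ(𝔣)/w_K`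
for `w_𝔣 = 1`). [cite: deShalit1987, II.1.9 (p. 43)] [cite: NeukirchANT1999, Ch. VI §1 Prop. (1.11)] -/
theorem natCard_rayClassGroup_mul_natCard_units_of_forall_units [IsTotallyComplex K] (h𝔪 : 𝔪 ≠ ⊥)
    (hw : ∀ u : (𝓞 K)ˣ, (u : 𝓞 K) - 1 ∈ 𝔪 → u = 1) :
    Nat.card (RayClassGroup 𝔪) * Nat.card (𝓞 K)ˣ = classNumber K * Nat.card (𝓞 K ⧸ 𝔪)ˣ := by
  have hinj : Function.Injective
      (Units.map (Ideal.Quotient.mk 𝔪).toMonoidHom : (𝓞 K)ˣ →* (𝓞 K ⧸ 𝔪)ˣ) := by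
    rw [injective_iff_map_eq_one]
    intro u hu
    refine hw u ?_
    rw [← Ideal.Quotient.eq, map_one]
    have h1 := congrArg (fun x : (𝓞 K ⧸ 𝔪)ˣ ↦ (x : 𝓞 K ⧸ 𝔪)) hu
    simpa using h1
  rw [← natCard_rayClassGroup_mul_natCard_range_units (K := K) h𝔪,
    Nat.card_congr (MonoidHom.ofInjective hinj).toEquiv]

/-! ### §3 A split prime above `2` in a quadratic field: `#Cl_K^{v} = h_K`, `[K(v^{n+1}) : K] = h_K · 2^{n-1}` -/

section Split

variable [IsTotallyComplex K] (hK2 : Module.finrank ℚ K = 2) {v vbar : HeightOneSpectrum (𝓞 K)}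
  (hv : ((2 : ℕ) : 𝓞 K) ∈ v.asIdeal) (hvbar : ((2 : ℕ) : 𝓞 K) ∈ vbar.asIdeal) (hne : vbar ≠ v)

omit [IsTotallyComplex K] in
/-- A residue field with two elements has trivial unit group: `#(𝓞/v) = 2 ⟹ #(𝓞/v)ˣ = 1`. [folklore] -/
theorem natCard_units_quotient_eq_one_of_natCard_eq_two (v : HeightOneSpectrum (𝓞 K))
    (h2 : Nat.card (𝓞 K ⧸ v.asIdeal) = 2) : Nat.card (𝓞 K ⧸ v.asIdeal)ˣ = 1 := by
  letI : v.asIdeal.IsMaximal := v.isMaximal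
  letI : Field (𝓞 K ⧸ v.asIdeal) := Ideal.Quotient.field v.asIdeal
  rw [Nat.card_units, h2]

include hK2 hv hvbar hne

/-- ★ **`#Cl_K^{v} = h_K`** for `[K:ℚ] = 2` totally complex and `2 = v v̄` split (`𝓞/v = 𝔽₂`, so
`(𝓞/v)ˣ = 1`): the ray class field `K(v)` is the Hilbert class field. [cite: deShalit1987, II.1.9 (p. 43)]
[cite: NeukirchANT1999, Ch. VI §1 Prop. (1.11)] -/
theorem natCard_rayClassGroup_eq_classNumber_of_split_two :
    Nat.card (RayClassGroup v.asIdeal) = classNumber K :=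
  natCard_rayClassGroup_eq_classNumber_of_natCard_units_eq_one v.ne_bot
    (natCard_units_quotient_eq_one_of_natCard_eq_two v
      (Literature.NumberTheory.NumberFields.natCard_quotient_eq_of_mem_of_mem_of_ne hK2 Nat.prime_two hv
        hvbar hne))

end Split

section SplitDegrees

variable {K : Type} [Field K] [NumberField K] [IsTotallyComplex K] (hK2 : Module.finrank ℚ K = 2)
  {v vbar : HeightOneSpectrum (𝓞 K)}
  (hv : ((2 : ℕ) : 𝓞 K) ∈ v.asIdeal) (hvbar : ((2 : ℕ) : 𝓞 K) ∈ vbar.asIdeal) (hne : vbar ≠ v)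
include hK2 hv hvbar hne

/-- **`[K(v) : K] = h_K`** (`[K:ℚ] = 2` totally complex, `2 = v v̄` split). [cite: deShalit1987, II.1.9 (p. 43)] -/
theorem finrank_rayClassField_eq_classNumber_of_split_two :
    Module.finrank K (Literature.NumberTheory.NumberFields.rayClassField K v.asIdeal) = classNumber K := by
  rw [Literature.NumberTheory.NumberFields.finrank_rayClassField v.ne_bot,
    natCard_rayClassGroup_eq_classNumber_of_split_two hK2 hv hvbar hne]

/-- ★★ **`[K(v^{n+1}) : K] = h_K · 2^{n-1}`** (`n ≥ 1`) for `[K:ℚ] = 2` totally complex with `𝓞_Kˣ = {±1}`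
and `2 = v v̄` split: the bottom `[K(v) : K] = h_K` under w3 g18's `[K(v^{n+1}) : K(v)] = 2^{n-1}`
(`finrank_rayClassField_pow_succ_eq`). [cite: deShalit1987, II.1.9 (p. 43)] -/
theorem finrank_rayClassField_pow_succ_eq_classNumber_mul (hunits : Nat.card (𝓞 K)ˣ = 2) {n : ℕ}
    (hn : 1 ≤ n) :
    Module.finrank K (Literature.NumberTheory.NumberFields.rayClassField K (v.asIdeal ^ (n + 1))) =
      classNumber K * 2 ^ (n - 1) := by
  rw [Literature.NumberTheory.NumberFields.finrank_rayClassField_pow_succ_eq hK2 hunits hv hvbar hne hn,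
    finrank_rayClassField_eq_classNumber_of_split_two hK2 hv hvbar hne]

end SplitDegrees

/-! ### §4 `K = ℚ(√-7)`: `K(v) = K` and `[K(v^{n+1}) : K] = 2^{n-1}` -/

section Seven

open Literature.NumberTheory.EllipticCurves

variable {K : Type} [Field K] [NumberField K]

/-- `h_K = 1` for `d_K = -7` (Minkowski: the tree's `isPrincipalIdealRing_of_sq_eq_intCast` at `√d_K ∈ 𝓞_K`,
`exists_sq_eq_discr`); private plumbing for §4. [cite: Marcus2018, Ch. 5 (after Cor. 2 of Thm. 37)] -/
private theorem classNumber_eq_one_of_discr_eq_neg_seven (hK2 : Module.finrank ℚ K = 2)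
    (hd : NumberField.discr K = -7) : classNumber K = 1 := by
  obtain ⟨-, -, δ, -, hδ⟩ := Literature.NumberTheory.QuadraticFields.Quadratic.exists_sq_eq_discr hK2
  have hθ : ((δ : 𝓞 K) : K) ^ 2 = ((NumberField.discr K : ℤ) : K) := by
    have := congrArg ((↑) : 𝓞 K → K) hδ
    push_cast at this
    exact this
  exact NumberField.classNumber_eq_one_iff.mpr
    (Literature.NumberTheory.QuadraticFields.Quadratic.isPrincipalIdealRing_of_sq_eq_intCast hK2 hθ
      (by rw [hd]; decide))

variable (hK : IsImaginaryQuadratic K) (hd : NumberField.discr K = -7) {v vbar : HeightOneSpectrum (𝓞 K)}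
  (hv : ((2 : ℕ) : 𝓞 K) ∈ v.asIdeal) (hvbar : ((2 : ℕ) : 𝓞 K) ∈ vbar.asIdeal) (hne : vbar ≠ v)
include hK hd hv hvbar hne

/-- **`#Cl_K^{v} = 1` for `K = ℚ(√-7)`, `2 = v v̄`.** [cite: deShalit1987, II.1.9 (p. 43)] -/
theorem natCard_rayClassGroup_eq_one_of_discr_eq_neg_seven : Nat.card (RayClassGroup v.asIdeal) = 1 := by
  haveI := hK.isTotallyComplex
  rw [natCard_rayClassGroup_eq_classNumber_of_split_two hK.1 hv hvbar hne,
    classNumber_eq_one_of_discr_eq_neg_seven hK.1 hd]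

/-- **`K(v) = K` for `K = ℚ(√-7)`, `2 = v v̄`**: the ray class field modulo `v` is trivial (`h_K = 1`,
`(𝓞/v)ˣ = 1`). [cite: deShalit1987, II.1.9 (p. 43)] -/
theorem rayClassField_eq_bot_of_discr_eq_neg_seven :
    Literature.NumberTheory.NumberFields.rayClassField K v.asIdeal = ⊥ := by
  haveI := hK.isTotallyComplex
  apply IntermediateField.finrank_eq_one_iff.mp
  rw [Literature.NumberTheory.NumberFields.finrank_rayClassField v.ne_bot,
    natCard_rayClassGroup_eq_one_of_discr_eq_neg_seven hK hd hv hvbar hne]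

/-- **`#Cl_K^{v^{n+1}} = 2^{n-1}`** (`n ≥ 1`) for `K = ℚ(√-7)`, `2 = v v̄`. [cite: deShalit1987, II.1.9 (p. 43)] -/
theorem natCard_rayClassGroup_pow_succ_of_discr_eq_neg_seven {n : ℕ} (hn : 1 ≤ n) :
    Nat.card (RayClassGroup (v.asIdeal ^ (n + 1))) = 2 ^ (n - 1) := by
  rw [Literature.NumberTheory.NumberFields.natCard_rayClassGroup_pow_succ_eq_of_isImaginaryQuadratic hK
      (by rw [hd]; norm_num) hv hvbar hne hn,
    natCard_rayClassGroup_eq_one_of_discr_eq_neg_seven hK hd hv hvbar hne, one_mul]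

/-- ★★ **`[K(v^{n+1}) : K] = 2^{n-1}`** (`n ≥ 1`) for `K = ℚ(√-7)` and `2 = v v̄` split — the ABSOLUTE degree of
the `n`-th layer of the `𝔣 = 1` division tower (the planner's (M9) instance «so `[K(𝔭^{n+1}) : K] = 2^{n-1}`»).
[cite: deShalit1987, II.1.9 (p. 43)] -/
theorem finrank_rayClassField_pow_succ_of_discr_eq_neg_seven {n : ℕ} (hn : 1 ≤ n) :
    Module.finrank K (Literature.NumberTheory.NumberFields.rayClassField K (v.asIdeal ^ (n + 1))) =
      2 ^ (n - 1) := by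
  haveI := hK.isTotallyComplex
  rw [Literature.NumberTheory.NumberFields.finrank_rayClassField (pow_ne_zero _ v.ne_bot),
    natCard_rayClassGroup_pow_succ_of_discr_eq_neg_seven hK hd hv hvbar hne hn]

/-- ★★ **Galois form: `[Γ_K : Gal(K̄/K(v^{n+1}))] = 2^{n-1}`** (`n ≥ 1`) for `K = ℚ(√-7)`, `2 = v v̄` — the
index in the absolute Galois group of the fixing subgroup of the `n`-th layer of the `𝔣 = 1` division
tower. [cite: deShalit1987, II.1.9 (p. 43), II.4.6 (p. 59)] -/
theorem index_fixingSubgroup_rayClassField_pow_succ_of_discr_eq_neg_seven {n : ℕ} (hn : 1 ≤ n) :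
    (Literature.NumberTheory.NumberFields.rayClassField K (v.asIdeal ^ (n + 1))).fixingSubgroup.index =
      2 ^ (n - 1) := by
  haveI : IsGalois K (AlgebraicClosure K) := {}
  rw [← IntermediateField.restrictNormalHom_ker, Subgroup.index_ker,
    MonoidHom.range_eq_top.2 (AlgEquiv.restrictNormalHom_surjective (AlgebraicClosure K)), Subgroup.card_top,
    IsGalois.card_aut_eq_finrank, finrank_rayClassField_pow_succ_of_discr_eq_neg_seven hK hd hv hvbar hne hn]

end Seven

end Summit.BirchSwinnertonDyer.BirchSwinnertonDyer.Theorems.PrintCf2.RayClassNumberFormula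

end
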